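import Summits.ValiantsHypothesis.ValiantsHypothesis.Theorems.MonotoneRestorationOrbitRestorationQPValueDerivation
import Summits.ValiantsHypothesis.ValiantsHypothesis.Theorems.MonotoneRestorationOrbitRestorationQPEquivariantTermsTools
import Literature.GroupTheory.PermutationGroups.SmallIndexSubgroups
import Literature.GroupTheory.PermutationGroups.SmallIndexSubgroupsAlternating
import HarnessLib

/-!
# Small orbits force rigid supports (the support theorem for VALUES; ORBIT currency, XIII)

Route MonotoneRestoration, crux `OrbitRestorationQP` (stmt-ValiantsHypothesis-18293), namespace
`Summit.ValiantsHypothesis.ValiantsHypothesis.Theorems.ValueSupport`.  Route-independent (no `Theses` import).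

The director's lane — "bound orbit width through rigid supports (support theorem)" — for the VALUES of a
computation (the currency of `…ValueOrbit*.lean`: by `orbitRestorationQP_iff_wideOrbitQP` the crux is a statement
about the `Sym(Fin n)`-orbits of intermediate values).  The easy direction (support `⇒` orbit `≤ (n+1)^k`) is
`ValueOrbit.orbit_bounded_of_supported`; here is the converse and its sharpening for affine values:

* `exists_altSupport_of_ncard_lt_choose` — **ORBIT ⇒ ALTERNATING SUPPORT** (Dixon–Mortimer 5.2B, tree
  `alternating_fixing_le_of_index_lt_choose`, applied to the stabiliser of the value): for `n > 8`, `1 ≤ k ≤ n/4`,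
  a polynomial with fewer than `C(n,k)` diagonal translates is fixed by every EVEN permutation fixing some set
  `X` of fewer than `k` indices pointwise;
* `fixes_of_fixesLine` — **LINES ARE FIXED EXACTLY** (`A_m` is perfect, Mathlib
  `commutator_alternatingGroup_eq_top`): if every even permutation fixing `X` pointwise maps `q ≠ 0` to a scalar
  multiple of itself and `|X| + 5 ≤ n`, then it fixes `q`;
* `ren_affine`, `coeff_affine_single`, `symFixes_of_altFixes_affine` — **AFFINE UPGRADE**: for a polynomial of
  total degree `≤ 1` the alternating pointwise stabiliser may be replaced by the full pointwise stabiliser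
  (`|X| + 4 ≤ n`): a genuine support in the sense of Dawar–Wilsenach Def. 6.1.

Everything is proved. [folklore]

## References
* J. D. Dixon, B. Mortimer, *Permutation Groups*, GTM 163 (1996), Thm 5.2B. [DixonMortimer1996]
* A. Dawar, G. Wilsenach, *Symmetric arithmetic circuits*, ToC 21 (2025), Def. 6.1, §6. [DawarWilsenach2025]
* M. Anderson, A. Dawar, *On symmetric circuits and fixed-point logics*, Theory Comput. Syst. 60 (2017), §3
  (support theorem). [AndersonDawar2016]
-/

noncomputable section

open scoped Classical

-- `Summit.ValiantsHypothesis.ValiantsHypothesis.…` is the tree's single-conjunct layout (Sub = Summit).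
set_option linter.dupNamespace false

namespace Summit.ValiantsHypothesis.ValiantsHypothesis.Theorems

namespace ValueSupport

open Equiv Literature.GroupTheory.PermutationGroups

variable {n : ℕ}

/-! ### Orbit ⇒ alternating support -/

/-- **Small orbit ⇒ small alternating support.**  For `n > 8`, `1 ≤ k`, `4k ≤ n`: a polynomial on the
`n × n` matrix with fewer than `C(n,k)` translates under the diagonal action of `Sym(Fin n)` is fixed by every
even permutation fixing pointwise some set `X` of fewer than `k` indices (Dixon–Mortimer 5.2B applied to the
stabiliser of `q`, whose index is the number of translates). [cite: DixonMortimer1996, Thm 5.2B] -/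
theorem exists_altSupport_of_ncard_lt_choose {k : ℕ} (hn : 8 < n) (hk : 1 ≤ k) (h4k : 4 * k ≤ n)
    (q : MvPolynomial (Fin n × Fin n) ℂ)
    (hq : (Set.range fun σ : Perm (Fin n) => ren σ q).ncard < n.choose k) :
    ∃ X : Finset (Fin n), X.card < k ∧
      ∀ ρ : Perm (Fin n), (∀ x ∈ X, ρ x = x) → Perm.sign ρ = 1 → ren ρ q = q := by
  let S : Subgroup (Perm (Fin n)) :=
    { carrier := {ρ | ren ρ q = q}
      mul_mem' := by
        intro a b ha hb
        simp only [Set.mem_setOf_eq] at ha hb ⊢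
        rw [ren_mul, hb, ha]
      one_mem' := ren_one q
      inv_mem' := by
        intro a ha
        simp only [Set.mem_setOf_eq] at ha ⊢
        conv_lhs => rw [← ha]
        exact ren_inv_ren a q }
  have hS : ∀ ρ : Perm (Fin n), ρ ∈ S ↔ ren ρ q = q := fun ρ => Iff.rfl
  have hindex : S.index ≤ (Set.range fun σ : Perm (Fin n) => ren σ q).ncard := by
    let f : Perm (Fin n) ⧸ S → Set.range (fun σ : Perm (Fin n) => ren σ q) :=
      fun c => ⟨ren c.out q, c.out, rfl⟩
    have hf : Function.Injective f := by
      intro a b hab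
      have hab' : ren a.out q = ren b.out q := congrArg Subtype.val hab
      rw [← QuotientGroup.out_eq' a, ← QuotientGroup.out_eq' b, QuotientGroup.eq, hS, ren_mul]
      have : ren a.out⁻¹ (ren b.out q) = ren a.out⁻¹ (ren a.out q) := by rw [hab']
      rw [this, ren_inv_ren]
    have := Nat.card_le_card_of_injective f hf
    rwa [Nat.card_coe_set_eq] at this
  have hidx : S.index < (Fintype.card (Fin n)).choose k := by
    rw [Fintype.card_fin]; exact hindex.trans_lt hq
  obtain ⟨X, hXk, hX⟩ := alternating_fixing_le_of_index_lt_choose S k (by rwa [Fintype.card_fin]) hk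
    (by rwa [Fintype.card_fin]) hidx
  exact ⟨X, hXk, fun ρ hρ hsign => (hS ρ).1 (hX ρ hρ hsign)⟩

/-! ### A stable line is fixed pointwise (perfectness of the alternating group) -/

/-- **A line stable under the alternating pointwise stabiliser is fixed by it.**  If `q ≠ 0` and every even
permutation fixing `X` pointwise maps `q` to a scalar multiple of `q`, and `|X| + 5 ≤ n`, then every such
permutation fixes `q`: the scalars form a character of `Alt(Fin n ∖ X)`, a perfect group (Mathlib
`commutator_alternatingGroup_eq_top`), so the character is trivial. [folklore] -/
theorem fixes_of_fixesLine {X : Finset (Fin n)} (h5 : X.card + 5 ≤ n) {q : MvPolynomial (Fin n × Fin n) ℂ}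
    (hq : q ≠ 0)
    (hline : ∀ ρ : Perm (Fin n), (∀ x ∈ X, ρ x = x) → Perm.sign ρ = 1 →
      ∃ u : ℂ, ren ρ q = MvPolynomial.C u * q) :
    ∀ ρ : Perm (Fin n), (∀ x ∈ X, ρ x = x) → Perm.sign ρ = 1 → ren ρ q = q := by
  -- the alternating group of the free points, acting through `ofSubtype`
  let A := alternatingGroup {x : Fin n // x ∉ X}
  let ι : A → Perm (Fin n) := fun g => Perm.ofSubtype (g : Perm {x : Fin n // x ∉ X})
  have hιmul : ∀ g h : A, ι (g * h) = ι g * ι h := fun g h => by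
    simp only [ι, Subgroup.coe_mul, map_mul]
  have hιfix : ∀ g : A, ∀ x ∈ X, ι g x = x := fun g x hx => ofSubtype_alternatingGroup_apply_of_mem X g hx
  have hιsign : ∀ g : A, Perm.sign (ι g) = 1 := fun g => sign_ofSubtype_alternatingGroup X g
  -- the scalar of each element
  choose u hu using fun g : A => hline (ι g) (hιfix g) (hιsign g)
  have hu0 : ∀ g : A, u g ≠ 0 := by
    intro g hg
    have : ren (ι g) q = 0 := by rw [hu g, hg, map_zero, zero_mul]
    exact hq (ren_injective (ι g) (by rw [this, map_zero]))
  have hu1 : u 1 = 1 := by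
    have h := hu 1
    rw [show ι 1 = 1 from by simp [ι], ren_one] at h
    have h' : MvPolynomial.C (u 1) * q = MvPolynomial.C 1 * q := by rw [← h, map_one, one_mul]
    exact MvPolynomial.C_injective _ _ (mul_right_cancel₀ hq h')
  have humul : ∀ g h : A, u (g * h) = u g * u h := by
    intro g h
    have e1 : ren (ι (g * h)) q = MvPolynomial.C (u g * u h) * q := by
      rw [hιmul, ren_mul, hu h, map_mul, ren_C, hu g, map_mul]; ring
    have e2 := hu (g * h)
    rw [e2] at e1
    exact MvPolynomial.C_injective _ _ (mul_right_cancel₀ hq e1)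
  -- the character
  let χ : A →* ℂˣ :=
    { toFun := fun g => Units.mk0 (u g) (hu0 g)
      map_one' := Units.ext (by simp [hu1])
      map_mul' := fun g h => Units.ext (by simp [humul]) }
  have hcard : 5 ≤ Nat.card {x : Fin n // x ∉ X} := by
    rw [Nat.card_eq_fintype_card, Fintype.card_subtype_compl, Fintype.card_fin, Fintype.card_coe]
    omega
  have hker : ∀ g : A, χ g = 1 := by
    intro g
    have hg : g ∈ χ.ker := by
      have h1 : commutator A ≤ χ.ker := Abelianization.commutator_subset_ker χ
      rw [commutator_alternatingGroup_eq_top hcard] at h1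
      exact h1 (Subgroup.mem_top g)
    exact hg
  have hug : ∀ g : A, u g = 1 := fun g => by
    have := congrArg (fun z : ℂˣ => (z : ℂ)) (hker g)
    simpa [χ] using this
  intro ρ hρ hsign
  obtain ⟨g, hg⟩ := exists_alternatingGroup_ofSubtype_eq X ρ hρ hsign
  have := hu g
  rw [hug g, map_one, one_mul] at this
  rw [← hg]; exact this

/-! ### Affine values: coefficients and renaming -/

/-- Renaming an affine form permutes its coefficients: `ren ρ (c₀ + Σ_p c_p x_p) = c₀ + Σ_p c_{ρ⁻¹ p} x_p`.
[folklore] -/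
theorem ren_affine (ρ : Perm (Fin n)) (c₀ : ℂ) (c : Fin n × Fin n → ℂ) :
    ren ρ (MvPolynomial.C c₀ + ∑ p, MvPolynomial.C (c p) * MvPolynomial.X p) =
      MvPolynomial.C c₀ + ∑ p, MvPolynomial.C (c (ρ⁻¹ • p)) * MvPolynomial.X p := by
  rw [map_add, ren_C, map_sum]
  simp only [map_mul, ren_C, ren_X]
  congr 1
  exact Fintype.sum_equiv (MulAction.toPerm ρ) _ _ fun p => by
    simp [MulAction.toPerm_apply, inv_smul_smul]

/-- The coefficient of `x_p` in an affine form. [folklore] -/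
theorem coeff_affine_single (c₀ : ℂ) (c : Fin n × Fin n → ℂ) (p : Fin n × Fin n) :
    MvPolynomial.coeff (Finsupp.single p 1) (MvPolynomial.C c₀ + ∑ p', MvPolynomial.C (c p') * MvPolynomial.X p') =
      c p := by
  rw [MvPolynomial.coeff_add, MvPolynomial.coeff_C, if_neg (Finsupp.single_ne_zero.2 one_ne_zero).symm, zero_add,
    MvPolynomial.coeff_sum]
  simp only [MvPolynomial.coeff_C_mul, MvPolynomial.coeff_X, Finsupp.single_left_inj one_ne_zero]
  rw [Finset.sum_eq_single p]
  · simp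
  · intro b _ hb; simp [hb]
  · intro h; exact absurd (Finset.mem_univ p) h

/-- An affine form is fixed by `ρ` iff its coefficient function is `ρ`-invariant. [folklore] -/
theorem ren_affine_eq_self_iff (ρ : Perm (Fin n)) (c₀ : ℂ) (c : Fin n × Fin n → ℂ) :
    ren ρ (MvPolynomial.C c₀ + ∑ p, MvPolynomial.C (c p) * MvPolynomial.X p) =
        MvPolynomial.C c₀ + ∑ p, MvPolynomial.C (c p) * MvPolynomial.X p ↔
      ∀ p, c (ρ⁻¹ • p) = c p := by
  rw [ren_affine]
  constructor
  · intro h p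
    have := congrArg (MvPolynomial.coeff (Finsupp.single p 1)) h
    rwa [coeff_affine_single, coeff_affine_single] at this
  · intro h
    simp only [h]

/-- **Affine upgrade.**  A polynomial of total degree `≤ 1` fixed by every EVEN permutation fixing `X`
pointwise (`|X| + 4 ≤ n`) is fixed by EVERY permutation fixing `X` pointwise: an odd one is corrected by a
transposition of two free indices away from the (at most two) indices of the coefficient being compared.
[folklore] -/
theorem symFixes_of_altFixes_affine {X : Finset (Fin n)} (h4 : X.card + 4 ≤ n)
    {q : MvPolynomial (Fin n × Fin n) ℂ} (hq : q.totalDegree ≤ 1)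
    (h : ∀ ρ : Perm (Fin n), (∀ x ∈ X, ρ x = x) → Perm.sign ρ = 1 → ren ρ q = q) :
    ∀ ρ : Perm (Fin n), (∀ x ∈ X, ρ x = x) → ren ρ q = q := by
  set c₀ := MvPolynomial.coeff 0 q with hc₀
  set c : Fin n × Fin n → ℂ := fun p => MvPolynomial.coeff (Finsupp.single p 1) q with hc
  have hqe : q = MvPolynomial.C c₀ + ∑ p, MvPolynomial.C (c p) * MvPolynomial.X p := eqvTerms_affine_eq q hq
  have hinv : ∀ g : Perm (Fin n), (∀ x ∈ X, g x = x) → Perm.sign g = 1 → ∀ p, c (g⁻¹ • p) = c p := by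
    intro g hg hs
    have := h g hg hs
    rw [hqe] at this
    exact (ren_affine_eq_self_iff g c₀ c).1 this
  intro ρ hρ
  rw [hqe, ren_affine_eq_self_iff]
  intro p
  rcases Int.units_eq_one_or (Perm.sign ρ) with hs | hs
  · exact hinv ρ hρ hs p
  · -- two free indices away from `X` and from the indices of `ρ⁻¹ • p`
    set p' := ρ⁻¹ • p with hp'
    have hbig : 1 < (Finset.univ \ (X ∪ {p'.1, p'.2})).card := by
      rw [Finset.card_sdiff_of_subset (Finset.subset_univ _), Finset.card_univ, Fintype.card_fin]
      have := (Finset.card_union_le X {p'.1, p'.2}).trans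
        (Nat.add_le_add_left (Finset.card_insert_le _ _) _)
      rw [Finset.card_singleton] at this
      omega
    obtain ⟨w, hw, w', hw', hww⟩ := Finset.one_lt_card.1 hbig
    simp only [Finset.mem_sdiff, Finset.mem_univ, Finset.mem_union, Finset.mem_insert, Finset.mem_singleton,
      true_and, not_or] at hw hw'
    set g := ρ * swap w w' with hg
    have hgX : ∀ x ∈ X, g x = x := by
      intro x hx
      rw [hg, Perm.mul_apply, swap_apply_of_ne_of_ne, hρ x hx]
      · rintro rfl; exact hw.1 hx
      · rintro rfl; exact hw'.1 hx
    have hgs : Perm.sign g = 1 := by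
      rw [hg, Perm.sign_mul, Perm.sign_swap hww, hs]; decide
    have hgp : g⁻¹ • p = p' := by
      rw [hg, mul_inv_rev, mul_smul, swap_inv, ← hp']
      refine Prod.ext ?_ ?_ <;> simp only [Prod.smul_fst, Prod.smul_snd, Perm.smul_def]
      · exact swap_apply_of_ne_of_ne (Ne.symm hw.2.1) (Ne.symm hw'.2.1)
      · exact swap_apply_of_ne_of_ne (Ne.symm hw.2.2) (Ne.symm hw'.2.2)
    have := hinv g hgX hgs p
    rwa [hgp] at this

/-- **Orbit ⇒ support, for affine values.**  For `n > 8`, `1 ≤ k`, `4k ≤ n`, an affine form (total degree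
`≤ 1`) with fewer than `C(n,k)` diagonal translates is fixed by the pointwise stabiliser of fewer than `k`
indices; in particular (by `ValueOrbit.orbit_bounded_of_supported`) its orbit has at most `(n+1)^(k-1)`
elements.  [folklore; cite: DawarWilsenach2025, Def. 6.1] -/
theorem exists_support_affine_of_ncard_lt_choose {k : ℕ} (hn : 8 < n) (hk : 1 ≤ k) (h4k : 4 * k ≤ n)
    {q : MvPolynomial (Fin n × Fin n) ℂ} (hdeg : q.totalDegree ≤ 1)
    (hq : (Set.range fun σ : Perm (Fin n) => ren σ q).ncard < n.choose k) :
    ∃ X : Finset (Fin n), X.card < k ∧ ∀ ρ : Perm (Fin n), (∀ x ∈ X, ρ x = x) → ren ρ q = q := by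
  obtain ⟨X, hXk, hX⟩ := exists_altSupport_of_ncard_lt_choose hn hk h4k q hq
  exact ⟨X, hXk, symFixes_of_altFixes_affine (by omega) hdeg hX⟩

end ValueSupport

end Summit.ValiantsHypothesis.ValiantsHypothesis.Theorems

end
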